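import Literature.Analysis.FluidPDE.FourierL2Trajectory
import Literature.Analysis.FluidPDE.FourierL2Duhamel
import HarnessLib

/-!
# The Picard iterates of a Sobolev-class datum: the qualitative class

Eighth file of the weighted-`L²` Fourier-side construction of the local smooth solution of the
Navier–Stokes system with `H¹`-controlled lifespan (discharge of
`Literature.Analysis.FluidPDE.tao2011_fourier_local_existence`; Tao 2013, Thm. 5.4 (ii)+(iv)).
The tree's Picard iteration (`FourierNS.picardIter c T a`, `NSFourierPicard`) is run for a datum
`a` that is only *weighted square integrable of every order* (the transform of an `H^∞` field).
Writing each iterate as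

  `v_n(t, ξ) = e^{-c‖ξ‖² clamp(t)} a(ξ) - E_n(t, ξ)`   (`E_0 = 0`, `E_{n+1} = duhamelIntegral c T v_n`),

this file establishes by induction on `n` the **qualitative class** of the Duhamel parts `E_n`
— jointly continuous on `ℝ × E` with pointwise polynomial decay of every order, uniformly in time
(the tree's class `HasDecay`) — together with the resulting properties of the trajectories `v_n`
consumed by the quantitative estimates (`FourierL2DuhamelStep`, `FourierL2DuhamelIntegrated`):
measurable slices, square-integrable and `L²`-continuous components, joint measurability and
finite weighted square moments of every order.

* `lintegral_weight_majorant_sub_sq_le`: moments of `v = h - E` from those of `a` and the decay of `E`;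
* `traj_of_class`: the trajectory package for `v = h - E`;
* `weight_mul_enorm_duhamelIntegral_le`: pointwise weighted bound
  `(1+‖ξ‖)^K ‖duhamelIntegral c T v t ξ‖ₑ ≤ T · 4π·card² · 2^{K+2} S₀^{1/2} S_{K+1}^{1/2}` from uniform
  moment bounds `∫⁻ (w^k ∑ⱼ‖v s ·j‖ₑ)² ≤ S_k` (heat factor `≤ 1`, Peetre, Cauchy–Schwarz);
* `class_duhamelIntegral`, `class_picardIter`: the class is preserved by the Duhamel map, hence
  holds for every iterate;
* primed twins `aestronglyMeasurable_hsub_slice'`, `memLp_hsub_apply'`, `tendsto_eLpNorm_hsub_apply'`,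
  `aestronglyMeasurable_uncurry_hsub'`, `class_duhamelIntegral'` for the WIDER class in which `E` is
  only jointly measurable and continuous in time at each frequency (`Measurable (uncurry E)`,
  `∀ η, Continuous fun s => E s η`) — all that the proofs use of the joint continuity of `E`; this
  is the class of `E = D - F` with `D` jointly continuous and `F` a forcing term
  `∫₀ᵗ heat(t-s) • b(s) ds` whose coefficient `b` (a Leray-projected transform) is discontinuous
  at `ξ = 0` (the forced twin `ForcedFourier*` of this chain, Tao 2013, Thm. 5.4 WITH force). The
  unprimed statements are the specialisations to jointly continuous `E`.

No smallness condition is involved here; the constants depend on `n`.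

## References

* T. Tao, Anal. PDE 6 (2013) = arXiv:1108.1165, proof of Thm. 5.1/5.4 (arXiv pp. 16, 18).
  [Tao2011]
* J. Leray, Acta Math. 63 (1934), §19 (successive approximations). [Leray1934]
-/

noncomputable section

open MeasureTheory Real Set Filter Function intervalIntegral
open scoped ENNReal NNReal
open _root_.Topology

namespace Literature.Analysis.FluidPDE.FourierNS

variable {ι : Type*} [Fintype ι] [DecidableEq ι]
variable {c T : ℝ} {a : EuclideanSpace ℝ ι → ι → ℂ} {E : ℝ → EuclideanSpace ℝ ι → ι → ℂ}

/-! ### Moments of a trajectory `v = h - E` -/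

omit [DecidableEq ι] in
/-- **Weighted square moments of `h - E`**: for `c ≥ 0`, a weight `W` and a time `s`,
`∫⁻ (W ∑ⱼ ‖(heat • a - E s) η j‖ₑ)² ≤ 2 ∫⁻ (W ∑ⱼ‖a η j‖ₑ)² + 2 ∫⁻ (W ∑ⱼ‖E s η j‖ₑ)²`
(`|heat| ≤ 1` and `(x + y)² ≤ 2x² + 2y²`). [folklore] -/
theorem lintegral_weight_majorant_sub_sq_le (hc : 0 ≤ c) (ha : AEStronglyMeasurable a volume)
    {W : EuclideanSpace ℝ ι → ℝ≥0∞} (hW : Measurable W) (s : ℝ) :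
    ∫⁻ η, (W η * ∑ j, ‖(heat c η (clamp T s) • a η - E s η) j‖ₑ) ^ 2 ≤
      2 * (∫⁻ η, (W η * ∑ j, ‖a η j‖ₑ) ^ 2) + 2 * (∫⁻ η, (W η * ∑ j, ‖E s η j‖ₑ) ^ 2) := by
  have hsq : ∀ x y : ℝ≥0∞, (x + y) ^ 2 ≤ 2 * x ^ 2 + 2 * y ^ 2 := fun x y => by
    have h := ENNReal.rpow_add_le_mul_rpow_add_rpow x y (p := 2) (by norm_num)
    norm_num at h
    rw [← mul_add]
    exact_mod_cast h
  calc ∫⁻ η, (W η * ∑ j, ‖(heat c η (clamp T s) • a η - E s η) j‖ₑ) ^ 2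
      ≤ ∫⁻ η, (2 * (W η * ∑ j, ‖a η j‖ₑ) ^ 2 + 2 * (W η * ∑ j, ‖E s η j‖ₑ) ^ 2) := by
        refine lintegral_mono fun η => ?_
        have hpt : (∑ j, ‖(heat c η (clamp T s) • a η - E s η) j‖ₑ) ≤
            (∑ j, ‖a η j‖ₑ) + ∑ j, ‖E s η j‖ₑ := by
          rw [← Finset.sum_add_distrib]
          refine Finset.sum_le_sum fun j _ => ?_
          rw [Pi.sub_apply]
          exact (enorm_sub_le).trans (add_le_add (enorm_heat_smul_apply_le hc s η j) le_rfl)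
        calc (W η * ∑ j, ‖(heat c η (clamp T s) • a η - E s η) j‖ₑ) ^ 2
            ≤ (W η * ((∑ j, ‖a η j‖ₑ) + ∑ j, ‖E s η j‖ₑ)) ^ 2 := by gcongr
          _ = (W η * ∑ j, ‖a η j‖ₑ + W η * ∑ j, ‖E s η j‖ₑ) ^ 2 := by rw [mul_add]
          _ ≤ _ := hsq _ _
    _ ≤ 2 * (∫⁻ η, (W η * ∑ j, ‖a η j‖ₑ) ^ 2) + 2 * (∫⁻ η, (W η * ∑ j, ‖E s η j‖ₑ) ^ 2) := by
        rw [← lintegral_const_mul' _ _ (by norm_num), ← lintegral_const_mul' _ _ (by norm_num)]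
        exact le_of_eq (lintegral_add_left' (((hW.aemeasurable.mul (aemeasurable_majorant ha)).pow_const 2
          ).const_mul 2) _)

omit [DecidableEq ι] in
/-- **Weighted square moments of a decaying field**: if `HasDecay (k + m) B u` with `2m > dim`
then `∫⁻ (w^k ∑ⱼ‖u η j‖ₑ)² ≤ (card ι)² B² ∫⁻ w^{-2m} < ∞`. [folklore] -/
theorem lintegral_weight_majorant_sq_le_of_hasDecay {u : EuclideanSpace ℝ ι → ι → ℂ} {k m : ℕ} {B : ℝ}
    (hu : HasDecay (k + m) B u) :
    ∫⁻ η, (ENNReal.ofReal ((1 + ‖η‖) ^ k) * ∑ j, ‖u η j‖ₑ) ^ 2 ≤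
      ((Fintype.card ι : ℝ≥0∞) * ENNReal.ofReal B) ^ 2 *
        ∫⁻ η : EuclideanSpace ℝ ι, (ENNReal.ofReal ((1 + ‖η‖) ^ m))⁻¹ ^ 2 := by
  rw [← lintegral_const_mul' _ _ (ENNReal.pow_ne_top (ENNReal.mul_ne_top (by simp) ENNReal.ofReal_ne_top))]
  refine lintegral_mono fun η => ?_
  rw [← mul_pow]
  refine pow_le_pow_left' ?_ 2
  have hcomp : ∀ j, ‖u η j‖ₑ ≤ ENNReal.ofReal B * (ENNReal.ofReal ((1 + ‖η‖) ^ (k + m)))⁻¹ :=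
    fun j => (hu.apply j).enorm_le η
  calc ENNReal.ofReal ((1 + ‖η‖) ^ k) * ∑ j, ‖u η j‖ₑ
      ≤ ENNReal.ofReal ((1 + ‖η‖) ^ k) * ∑ _j : ι, ENNReal.ofReal B *
          (ENNReal.ofReal ((1 + ‖η‖) ^ (k + m)))⁻¹ := by
        gcongr with j _; exact hcomp j
    _ = (Fintype.card ι : ℝ≥0∞) * ENNReal.ofReal B * (ENNReal.ofReal ((1 + ‖η‖) ^ k) *
          (ENNReal.ofReal ((1 + ‖η‖) ^ (k + m)))⁻¹) := by
        simp only [Finset.sum_const, Finset.card_univ, nsmul_eq_mul]; ring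
    _ = (Fintype.card ι : ℝ≥0∞) * ENNReal.ofReal B * (ENNReal.ofReal ((1 + ‖η‖) ^ m))⁻¹ := by
        congr 1
        have hpos : ∀ n : ℕ, (0 : ℝ) < (1 + ‖η‖) ^ n := fun n => by positivity
        have hk0 : ENNReal.ofReal ((1 + ‖η‖) ^ k) ≠ 0 := (ENNReal.ofReal_pos.2 (hpos k)).ne'
        rw [pow_add, ENNReal.ofReal_mul (hpos k).le,
          ENNReal.mul_inv (Or.inl hk0) (Or.inl ENNReal.ofReal_ne_top), ← mul_assoc,
          ENNReal.mul_inv_cancel hk0 ENNReal.ofReal_ne_top, one_mul]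

/-! ### The trajectory package of `v = h - E` -/

section Traj

variable (c T a E)

omit [DecidableEq ι] in
/-- Slices of `h - E` are measurable (`E` jointly measurable).
[cite: Tao2011, Thm. 5.4 (ii) WITH force (arXiv:1108.1165 Thm. 31 (ii), p. 18);
proof of Thm. 5.1 (arXiv Thm. 28, p. 16)] -/
theorem aestronglyMeasurable_hsub_slice' (ha : AEStronglyMeasurable a volume)
    (hEm : Measurable (uncurry E)) (s : ℝ) :
    AEStronglyMeasurable (fun η => heat c η (clamp T s) • a η - E s η) volume :=
  (aestronglyMeasurable_heat_smul ha s).sub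
    (show Measurable fun η => E s η from hEm.comp measurable_prodMk_left).aestronglyMeasurable

omit [DecidableEq ι] in
/-- Slices of `h - E` are measurable (`E` jointly continuous). [folklore] -/
theorem aestronglyMeasurable_hsub_slice (ha : AEStronglyMeasurable a volume) (hEc : Continuous (uncurry E))
    (s : ℝ) : AEStronglyMeasurable (fun η => heat c η (clamp T s) • a η - E s η) volume :=
  aestronglyMeasurable_hsub_slice' c T a E ha hEc.measurable s

omit [DecidableEq ι] in
/-- Components of `h - E` are square integrable (`c ≥ 0`, `∫|aⱼ|² < ∞`, `E` jointly measurable with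
decay of order `K > dim/2`).
[cite: Tao2011, Thm. 5.4 (ii) WITH force (arXiv:1108.1165 Thm. 31 (ii), p. 18);
proof of Thm. 5.1 (arXiv Thm. 28, p. 16)] -/
theorem memLp_hsub_apply' (hc : 0 ≤ c) (ha : AEStronglyMeasurable a volume)
    (ha2 : ∀ j, ∫⁻ η, ‖a η j‖ₑ ^ 2 < ⊤) (hEm : Measurable (uncurry E)) {K : ℕ} {B : ℝ}
    (hK : Module.finrank ℝ (EuclideanSpace ℝ ι) < 2 * K) (hEd : ∀ t, HasDecay K B (E t))
    (s : ℝ) (j : ι) : MemLp (fun η => (heat c η (clamp T s) • a η - E s η) j) 2 volume := by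
  have h1 := memLp_heat_smul_apply (T := T) hc ha j (ha2 j) s
  have h2 : MemLp (fun η => E s η j) 2 volume :=
    memLp_two_of_hasDecay_half hK ((hEd s).apply j)
      (aesm_apply (show Measurable fun η => E s η from
        hEm.comp measurable_prodMk_left).aestronglyMeasurable j)
  exact h1.sub h2

omit [DecidableEq ι] in
/-- Components of `h - E` are square integrable (`c ≥ 0`, `∫|aⱼ|² < ∞`, decay of order `K > dim/2`).
[folklore] -/
theorem memLp_hsub_apply (hc : 0 ≤ c) (ha : AEStronglyMeasurable a volume)
    (ha2 : ∀ j, ∫⁻ η, ‖a η j‖ₑ ^ 2 < ⊤) (hEc : Continuous (uncurry E)) {K : ℕ} {B : ℝ}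
    (hK : Module.finrank ℝ (EuclideanSpace ℝ ι) < 2 * K) (hEd : ∀ t, HasDecay K B (E t))
    (s : ℝ) (j : ι) : MemLp (fun η => (heat c η (clamp T s) • a η - E s η) j) 2 volume :=
  memLp_hsub_apply' c T a E hc ha ha2 hEc.measurable hK hEd s j

omit [DecidableEq ι] in
/-- **`L²`-continuity in time of a trajectory with measurable slices, continuous in time at each
frequency, with uniform decay** of order `K > dim/2`, componentwise (dominated convergence,
domination by `B (1 + ‖ξ‖)^{-K}`; twin of `tendsto_eLpNorm_sub_of_hasDecay` without joint
continuity).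
[cite: Tao2011, Thm. 5.4 (ii) WITH force (arXiv:1108.1165 Thm. 31 (ii), p. 18);
proof of Thm. 5.1 (arXiv Thm. 28, p. 16)] -/
theorem tendsto_eLpNorm_sub_of_hasDecay' {D : ℝ → EuclideanSpace ℝ ι → ι → ℂ} {K : ℕ} {B : ℝ}
    (hK : Module.finrank ℝ (EuclideanSpace ℝ ι) < 2 * K)
    (hDm : ∀ s, AEStronglyMeasurable (D s) volume) (hDt : ∀ η, Continuous fun s => D s η)
    (hD : ∀ t, HasDecay K B (D t)) (j : ι) (s₀ : ℝ) :
    Tendsto (fun s => eLpNorm ((D s · j) - (D s₀ · j)) 2 volume) (𝓝 s₀) (𝓝 0) :=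
  tendsto_eLpNorm_sub_of_dominated (G := fun s η => D s η j) (fun s => aesm_apply (hDm s) j)
    (fun η => ENNReal.ofReal B * (ENNReal.ofReal ((1 + ‖η‖) ^ K))⁻¹)
    (fun s η => ((hD s).apply j).enorm_le η) (lintegral_decayProfile_sq_lt_top hK B).ne
    (fun η => (continuous_apply j).comp (hDt η)) s₀

omit [DecidableEq ι] in
/-- `L²`-continuity in time of the components of `h - E` (`E` jointly measurable, continuous in time
at each frequency, with decay of order `K > dim/2`).
[cite: Tao2011, Thm. 5.4 (ii) WITH force (arXiv:1108.1165 Thm. 31 (ii), p. 18);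
proof of Thm. 5.1 (arXiv Thm. 28, p. 16)] -/
theorem tendsto_eLpNorm_hsub_apply' (hc : 0 ≤ c) (ha : AEStronglyMeasurable a volume)
    (ha2 : ∀ j, ∫⁻ η, ‖a η j‖ₑ ^ 2 < ⊤) (hEm : Measurable (uncurry E))
    (hEt : ∀ η, Continuous fun s => E s η) {K : ℕ} {B : ℝ}
    (hK : Module.finrank ℝ (EuclideanSpace ℝ ι) < 2 * K) (hEd : ∀ t, HasDecay K B (E t)) (j : ι) (s₀ : ℝ) :
    Tendsto (fun s => eLpNorm ((fun η => (heat c η (clamp T s) • a η - E s η) j) -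
      (fun η => (heat c η (clamp T s₀) • a η - E s₀ η) j)) 2 volume) (𝓝 s₀) (𝓝 0) := by
  have hEs : ∀ s, AEStronglyMeasurable (E s) volume := fun s =>
    (show Measurable fun η => E s η from hEm.comp measurable_prodMk_left).aestronglyMeasurable
  have h := tendsto_eLpNorm_sub_sub (F := fun s η => (heat c η (clamp T s) • a η) j)
    (G := fun s η => E s η j) (fun s => aesm_apply (aestronglyMeasurable_heat_smul ha s) j)
    (fun s => aesm_apply (hEs s) j)
    (tendsto_eLpNorm_heat_sub hc ha j (ha2 j) s₀) (tendsto_eLpNorm_sub_of_hasDecay' hK hEs hEt hEd j s₀)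
  refine h.congr fun s => ?_
  congr 1

omit [DecidableEq ι] in
/-- `L²`-continuity in time of the components of `h - E`. [folklore] -/
theorem tendsto_eLpNorm_hsub_apply (hc : 0 ≤ c) (ha : AEStronglyMeasurable a volume)
    (ha2 : ∀ j, ∫⁻ η, ‖a η j‖ₑ ^ 2 < ⊤) (hEc : Continuous (uncurry E)) {K : ℕ} {B : ℝ}
    (hK : Module.finrank ℝ (EuclideanSpace ℝ ι) < 2 * K) (hEd : ∀ t, HasDecay K B (E t)) (j : ι) (s₀ : ℝ) :
    Tendsto (fun s => eLpNorm ((fun η => (heat c η (clamp T s) • a η - E s η) j) -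
      (fun η => (heat c η (clamp T s₀) • a η - E s₀ η) j)) 2 volume) (𝓝 s₀) (𝓝 0) :=
  tendsto_eLpNorm_hsub_apply' c T a E hc ha ha2 hEc.measurable (fun η => hEc.uncurry_right η) hK hEd j s₀

omit [DecidableEq ι] in
/-- Joint measurability of `h - E` on `ℝ × E` (`E` jointly measurable).
[cite: Tao2011, Thm. 5.4 (ii) WITH force (arXiv:1108.1165 Thm. 31 (ii), p. 18);
proof of Thm. 5.1 (arXiv Thm. 28, p. 16)] -/
theorem aestronglyMeasurable_uncurry_hsub' (ha : AEStronglyMeasurable a volume)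
    (hEm : Measurable (uncurry E)) :
    AEStronglyMeasurable (uncurry fun s η => heat c η (clamp T s) • a η - E s η) (volume.prod volume) := by
  have h1 : AEStronglyMeasurable (fun z : ℝ × EuclideanSpace ℝ ι => heat c z.2 (clamp T z.1) • a z.2)
      (volume.prod volume) :=
    (continuous_heat_comp c continuous_snd ((continuous_clamp T).comp continuous_fst)).aestronglyMeasurable.smul
      (ha.comp_quasiMeasurePreserving Measure.quasiMeasurePreserving_snd)
  exact h1.sub hEm.aestronglyMeasurable

omit [DecidableEq ι] in
/-- Joint measurability of `h - E` on `ℝ × E`. [folklore] -/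
theorem aestronglyMeasurable_uncurry_hsub (ha : AEStronglyMeasurable a volume) (hEc : Continuous (uncurry E)) :
    AEStronglyMeasurable (uncurry fun s η => heat c η (clamp T s) • a η - E s η) (volume.prod volume) :=
  aestronglyMeasurable_uncurry_hsub' c T a E ha hEc.measurable

omit [DecidableEq ι] in
/-- **Weighted square moments of `h - E`** from the moments of `a` and the decay of `E`:
`∫⁻ (w^k ∑ⱼ‖(h - E)ⱼ‖ₑ)² ≤ 2∫⁻(w^k∑ⱼ‖aⱼ‖ₑ)² + 2 (card)² B² ∫⁻ w^{-2m}` if `HasDecay (k+m) B (E s)`.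
[folklore] -/
theorem lintegral_weight_majorant_hsub_sq_le (hc : 0 ≤ c) (ha : AEStronglyMeasurable a volume)
    {k m : ℕ} {B : ℝ} (s : ℝ) (hEd : HasDecay (k + m) B (E s)) :
    ∫⁻ η, (ENNReal.ofReal ((1 + ‖η‖) ^ k) * ∑ j, ‖(heat c η (clamp T s) • a η - E s η) j‖ₑ) ^ 2 ≤
      2 * (∫⁻ η, (ENNReal.ofReal ((1 + ‖η‖) ^ k) * ∑ j, ‖a η j‖ₑ) ^ 2) +
        2 * (((Fintype.card ι : ℝ≥0∞) * ENNReal.ofReal B) ^ 2 *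
          ∫⁻ η : EuclideanSpace ℝ ι, (ENNReal.ofReal ((1 + ‖η‖) ^ m))⁻¹ ^ 2) :=
  (lintegral_weight_majorant_sub_sq_le (E := E) hc ha (measurable_ofReal_weight k) s).trans
    (add_le_add le_rfl (mul_le_mul' le_rfl (lintegral_weight_majorant_sq_le_of_hasDecay hEd)))

end Traj

/-! ### Pointwise weighted bound of the Duhamel integral -/

section DuhamelDecay

variable {v : ℝ → EuclideanSpace ℝ ι → ι → ℂ}

/-- **Weighted pointwise bound of the Duhamel integral from uniform moment bounds.** For `c ≥ 0`,
`T ≥ 0`, measurable slices and `∫⁻ (∑ⱼ‖v s ·j‖ₑ)² ≤ S₀`, `∫⁻ (w^{K+1}∑ⱼ‖v s ·j‖ₑ)² ≤ S₁` for all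
`s`, every `t` and `ξ`:
`w^K(ξ) ‖duhamelIntegral c T v t ξ‖ₑ ≤ T · 4π(card ι)² 2^{K+2} S₀^{1/2} S₁^{1/2}`
(`heat ≤ 1`, `‖N‖ₑ ≤ 4π card² ‖ξ‖ (V ⋆ₗ V)`, `w^K‖ξ‖ ≤ w^{K+1}`, Peetre and Cauchy–Schwarz).
[folklore] -/
theorem weight_mul_enorm_duhamelIntegral_le (hc : 0 ≤ c) (hT : 0 ≤ T)
    (hvm : ∀ s, AEStronglyMeasurable (v s) volume) (K : ℕ) {S₀ S₁ : ℝ≥0∞}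
    (hS₀ : ∀ s, ∫⁻ η, (∑ j, ‖v s η j‖ₑ) ^ 2 ≤ S₀)
    (hS₁ : ∀ s, ∫⁻ η, (ENNReal.ofReal ((1 + ‖η‖) ^ (K + 1)) * ∑ j, ‖v s η j‖ₑ) ^ 2 ≤ S₁)
    (t : ℝ) (ξ : EuclideanSpace ℝ ι) :
    ENNReal.ofReal ((1 + ‖ξ‖) ^ K) * ‖duhamelIntegral c T v t ξ‖ₑ ≤
      ENNReal.ofReal T * (ENNReal.ofReal (4 * π) * (Fintype.card ι : ℝ≥0∞) ^ 2 * 2 ^ (K + 2) *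
        (S₀ ^ (1 / 2 : ℝ) * S₁ ^ (1 / 2 : ℝ))) := by
  -- sup norm from the components
  have hpi : ∀ {x : ι → ℂ} {b : ℝ≥0∞}, (∀ l, ‖x l‖ₑ ≤ b) → ‖x‖ₑ ≤ b := by
    intro x b h
    rcases eq_or_ne b ⊤ with hb | hb
    · rw [hb]; exact le_top
    rw [← ofReal_norm, ← ENNReal.ofReal_toReal hb]
    refine ENNReal.ofReal_le_ofReal ((pi_norm_le_iff_of_nonneg ENNReal.toReal_nonneg).2 fun l => ?_)
    rw [← ENNReal.ofReal_le_ofReal_iff ENNReal.toReal_nonneg, ofReal_norm, ENNReal.ofReal_toReal hb]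
    exact h l
  set C : ℝ≥0∞ := ENNReal.ofReal (4 * π) * (Fintype.card ι : ℝ≥0∞) ^ 2 with hC
  set V : ℝ → EuclideanSpace ℝ ι → ℝ≥0∞ := fun s η => ∑ j, ‖v s η j‖ₑ with hV
  have hVm : ∀ s, AEMeasurable (V s) volume := fun s => aemeasurable_majorant (hvm s)
  set τ := clamp T t with hτ
  have hτ0 : 0 ≤ τ := clamp_nonneg T t
  have hτT : τ ≤ T := clamp_le hT t
  -- Step 1: `‖D‖ₑ ≤ ∫⁻_{(0,T]} ‖N s‖ₑ`
  have h1 : ‖duhamelIntegral c T v t ξ‖ₑ ≤ ∫⁻ s in Ioc 0 T, ‖nonlin (v s) (v s) ξ‖ₑ := by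
    rw [duhamelIntegral]
    refine (enorm_duhamel_le_lintegral c ξ _ hτ0).trans ?_
    refine (setLIntegral_mono' measurableSet_Ioc fun s hs => ?_).trans (lintegral_mono_set
      (Ioc_subset_Ioc_right hτT))
    calc ENNReal.ofReal (heat c ξ (τ - s)) * ‖nonlin (v s) (v s) ξ‖ₑ ≤ 1 * ‖nonlin (v s) (v s) ξ‖ₑ := by
          gcongr
          rw [← ENNReal.ofReal_one]
          exact ENNReal.ofReal_le_ofReal (heat_le_one hc (by linarith [hs.2]) ξ)
      _ = _ := one_mul _
  -- Step 2: the weighted integrand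
  have h2 : ∀ s, ENNReal.ofReal ((1 + ‖ξ‖) ^ K) * ‖nonlin (v s) (v s) ξ‖ₑ ≤
      C * 2 ^ (K + 2) * (S₀ ^ (1 / 2 : ℝ) * S₁ ^ (1 / 2 : ℝ)) := by
    intro s
    have hN : ‖nonlin (v s) (v s) ξ‖ₑ ≤ C * (ENNReal.ofReal ‖ξ‖ * (V s ⋆ₗ V s) ξ) := by
      refine hpi fun l => ?_
      calc ‖nonlin (v s) (v s) ξ l‖ₑ ≤ _ := enorm_nonlin_apply_le (v s) (v s) ξ l
        _ = C * (ENNReal.ofReal ‖ξ‖ * (V s ⋆ₗ V s) ξ) := by rw [hC, hV]; ring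
    have hw : ENNReal.ofReal ((1 + ‖ξ‖) ^ K) * ENNReal.ofReal ‖ξ‖ ≤ ENNReal.ofReal ((1 + ‖ξ‖) ^ (K + 1)) := by
      rw [← ENNReal.ofReal_mul (by positivity), pow_succ]
      exact ENNReal.ofReal_le_ofReal (by gcongr; linarith [norm_nonneg ξ])
    have hpeetre := weight_mul_lconv_le (hVm s) (hVm s) (K + 1) ξ
    have hcs1 : (V s ⋆ₗ fun η => ENNReal.ofReal ((1 + ‖η‖) ^ (K + 1)) * V s η) ξ ≤
        S₀ ^ (1 / 2 : ℝ) * S₁ ^ (1 / 2 : ℝ) := by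
      refine (lconv_le_sqrt_mul_sqrt (hVm s) ((measurable_ofReal_weight (K + 1)).aemeasurable.mul (hVm s)) ξ).trans ?_
      gcongr
      · exact hS₀ s
      · exact hS₁ s
    have hcs2 : ((fun η => ENNReal.ofReal ((1 + ‖η‖) ^ (K + 1)) * V s η) ⋆ₗ V s) ξ ≤
        S₁ ^ (1 / 2 : ℝ) * S₀ ^ (1 / 2 : ℝ) := by
      refine (lconv_le_sqrt_mul_sqrt ((measurable_ofReal_weight (K + 1)).aemeasurable.mul (hVm s)) (hVm s) ξ).trans ?_
      gcongr
      · exact hS₁ s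
      · exact hS₀ s
    calc ENNReal.ofReal ((1 + ‖ξ‖) ^ K) * ‖nonlin (v s) (v s) ξ‖ₑ
        ≤ ENNReal.ofReal ((1 + ‖ξ‖) ^ K) * (C * (ENNReal.ofReal ‖ξ‖ * (V s ⋆ₗ V s) ξ)) := by gcongr
      _ = C * ((ENNReal.ofReal ((1 + ‖ξ‖) ^ K) * ENNReal.ofReal ‖ξ‖) * (V s ⋆ₗ V s) ξ) := by ring
      _ ≤ C * (ENNReal.ofReal ((1 + ‖ξ‖) ^ (K + 1)) * (V s ⋆ₗ V s) ξ) := by gcongr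
      _ ≤ C * (2 ^ (K + 1) * ((V s ⋆ₗ fun η => ENNReal.ofReal ((1 + ‖η‖) ^ (K + 1)) * V s η) ξ +
          ((fun η => ENNReal.ofReal ((1 + ‖η‖) ^ (K + 1)) * V s η) ⋆ₗ V s) ξ)) := by gcongr
      _ ≤ C * (2 ^ (K + 1) * (S₀ ^ (1 / 2 : ℝ) * S₁ ^ (1 / 2 : ℝ) + S₁ ^ (1 / 2 : ℝ) * S₀ ^ (1 / 2 : ℝ))) := by
          gcongr
      _ = C * 2 ^ (K + 2) * (S₀ ^ (1 / 2 : ℝ) * S₁ ^ (1 / 2 : ℝ)) := by ring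
  -- Step 3: integrate the constant bound over `(0, T]`
  calc ENNReal.ofReal ((1 + ‖ξ‖) ^ K) * ‖duhamelIntegral c T v t ξ‖ₑ
      ≤ ENNReal.ofReal ((1 + ‖ξ‖) ^ K) * ∫⁻ s in Ioc 0 T, ‖nonlin (v s) (v s) ξ‖ₑ := by gcongr
    _ = ∫⁻ s in Ioc 0 T, ENNReal.ofReal ((1 + ‖ξ‖) ^ K) * ‖nonlin (v s) (v s) ξ‖ₑ :=
        (lintegral_const_mul' _ _ ENNReal.ofReal_ne_top).symm
    _ ≤ ∫⁻ _s in Ioc 0 T, C * 2 ^ (K + 2) * (S₀ ^ (1 / 2 : ℝ) * S₁ ^ (1 / 2 : ℝ)) :=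
        lintegral_mono fun s => h2 s
    _ = ENNReal.ofReal T * (C * 2 ^ (K + 2) * (S₀ ^ (1 / 2 : ℝ) * S₁ ^ (1 / 2 : ℝ))) := by
        rw [setLIntegral_const, Real.volume_Ioc, sub_zero, mul_comm]

omit [DecidableEq ι] in
/-- From a uniform weighted `ℝ≥0∞` bound to the tree's `HasDecay`: if `w^K(ξ) ‖f ξ‖ₑ ≤ b < ∞` for
all `ξ` then `HasDecay K b.toReal f`. [folklore] -/
theorem hasDecay_of_weight_mul_enorm_le {F : Type*} [NormedAddCommGroup F] {f : EuclideanSpace ℝ ι → F}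
    {K : ℕ} {b : ℝ≥0∞} (hb : b ≠ ⊤) (h : ∀ ξ, ENNReal.ofReal ((1 + ‖ξ‖) ^ K) * ‖f ξ‖ₑ ≤ b) :
    HasDecay K b.toReal f := by
  intro ξ
  have hpos : (0 : ℝ) < (1 + ‖ξ‖) ^ K := by positivity
  have h1 := h ξ
  rw [← ofReal_norm, ← ENNReal.ofReal_mul hpos.le, ← ENNReal.ofReal_toReal hb,
    ENNReal.ofReal_le_ofReal_iff ENNReal.toReal_nonneg] at h1
  rw [← div_eq_mul_inv, le_div_iff₀ hpos, mul_comm]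
  exact h1

end DuhamelDecay

/-! ### The class is preserved by the Duhamel map; the class of every Picard iterate -/

section Class

omit [Fintype ι] [DecidableEq ι] in
/-- `dim < 2 (dim + 1)`: the decay margin used for square integrability. [folklore] -/
theorem finrank_lt_two_mul_succ :
    Module.finrank ℝ (EuclideanSpace ℝ ι) < 2 * (Module.finrank ℝ (EuclideanSpace ℝ ι) + 1) := by omega

/-- **The Duhamel map sends the wide class into the class.** For `c, T ≥ 0`, a measurable datum
with all weighted square moments finite and a jointly measurable `E`, continuous in time at each
frequency, with pointwise decay of every order uniformly in time, the Duhamel integral of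
`v = h - E` is jointly continuous with pointwise decay of every order uniformly in time (twin of
`class_duhamelIntegral` for the class of the forced chain).
[cite: Tao2011, Thm. 5.4 (ii) WITH force (arXiv:1108.1165 Thm. 31 (ii), p. 18);
proof of Thm. 5.1 (arXiv Thm. 28, p. 16)] -/
theorem class_duhamelIntegral' (hc : 0 ≤ c) (hT : 0 ≤ T) (ha : AEStronglyMeasurable a volume)
    (haw : ∀ (k : ℕ) j, ∫⁻ η, (ENNReal.ofReal ((1 + ‖η‖) ^ k) * ‖a η j‖ₑ) ^ 2 < ⊤)
    (hEm : Measurable (uncurry E)) (hEt : ∀ η, Continuous fun s => E s η)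
    (hEd : ∀ K : ℕ, ∃ B : ℝ, ∀ t, HasDecay K B (E t)) :
    Continuous (uncurry (duhamelIntegral c T (fun s η => heat c η (clamp T s) • a η - E s η))) ∧
      ∀ K : ℕ, ∃ B : ℝ, ∀ t,
        HasDecay K B (duhamelIntegral c T (fun s η => heat c η (clamp T s) • a η - E s η) t) := by
  set m₀ := Module.finrank ℝ (EuclideanSpace ℝ ι) + 1 with hm₀
  have hm₀lt : Module.finrank ℝ (EuclideanSpace ℝ ι) < 2 * m₀ := finrank_lt_two_mul_succ
  set v : ℝ → EuclideanSpace ℝ ι → ι → ℂ := fun s η => heat c η (clamp T s) • a η - E s η with hv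
  have ha2 : ∀ j, ∫⁻ η, ‖a η j‖ₑ ^ 2 < ⊤ := fun j => by simpa using haw 0 j
  obtain ⟨B₀, hB₀⟩ := hEd m₀
  have hvm : ∀ s, AEStronglyMeasurable (v s) volume := aestronglyMeasurable_hsub_slice' c T a E ha hEm
  have hv2 : ∀ s j, MemLp (v s · j) 2 volume := memLp_hsub_apply' c T a E hc ha ha2 hEm hm₀lt hB₀
  have hvc : ∀ j s₀, Tendsto (fun s => eLpNorm ((v s · j) - (v s₀ · j)) 2 volume) (𝓝 s₀) (𝓝 0) :=
    tendsto_eLpNorm_hsub_apply' c T a E hc ha ha2 hEm hEt hm₀lt hB₀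
  refine ⟨continuous_duhamelIntegral_of_tendsto hv2 hvc, fun K => ?_⟩
  -- uniform moment bounds of orders `0` and `K + 1`
  obtain ⟨B₁, hB₁⟩ := hEd (K + 1 + m₀)
  have hB₀' : ∀ t, HasDecay (0 + m₀) B₀ (E t) := fun t => by simpa using hB₀ t
  set I : ℝ≥0∞ := ∫⁻ η : EuclideanSpace ℝ ι, (ENNReal.ofReal ((1 + ‖η‖) ^ m₀))⁻¹ ^ 2 with hI
  have hItop : I < ⊤ := lintegral_weight_inv_sq_lt_top hm₀lt
  set S₀ : ℝ≥0∞ := 2 * (∫⁻ η, (ENNReal.ofReal ((1 + ‖η‖) ^ 0) * ∑ j, ‖a η j‖ₑ) ^ 2) +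
    2 * (((Fintype.card ι : ℝ≥0∞) * ENNReal.ofReal B₀) ^ 2 * I) with hS₀
  set S₁ : ℝ≥0∞ := 2 * (∫⁻ η, (ENNReal.ofReal ((1 + ‖η‖) ^ (K + 1)) * ∑ j, ‖a η j‖ₑ) ^ 2) +
    2 * (((Fintype.card ι : ℝ≥0∞) * ENNReal.ofReal B₁) ^ 2 * I) with hS₁
  have hAmom : ∀ k, ∫⁻ η, (ENNReal.ofReal ((1 + ‖η‖) ^ k) * ∑ j, ‖a η j‖ₑ) ^ 2 < ⊤ := fun k =>
    lt_of_le_of_lt (lintegral_weight_majorant_sq_le' ha k) (ENNReal.mul_lt_top (by simp)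
      (ENNReal.sum_lt_top.2 fun j _ => haw k j))
  have hS₀top : S₀ < ⊤ := by
    refine ENNReal.add_lt_top.2 ⟨ENNReal.mul_lt_top (by norm_num) (hAmom 0), ENNReal.mul_lt_top
      (by norm_num) (ENNReal.mul_lt_top (ENNReal.pow_lt_top (ENNReal.mul_lt_top (by simp)
        ENNReal.ofReal_lt_top)) hItop)⟩
  have hS₁top : S₁ < ⊤ := by
    refine ENNReal.add_lt_top.2 ⟨ENNReal.mul_lt_top (by norm_num) (hAmom (K + 1)), ENNReal.mul_lt_top
      (by norm_num) (ENNReal.mul_lt_top (ENNReal.pow_lt_top (ENNReal.mul_lt_top (by simp)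
        ENNReal.ofReal_lt_top)) hItop)⟩
  have hmom0 : ∀ s, ∫⁻ η, (∑ j, ‖v s η j‖ₑ) ^ 2 ≤ S₀ := fun s => by
    have h := lintegral_weight_majorant_hsub_sq_le c T a E hc ha s (hB₀' s)
    refine le_trans (le_of_eq (lintegral_congr fun η => ?_)) h
    rw [pow_zero, ENNReal.ofReal_one, one_mul]
  have hmom1 : ∀ s, ∫⁻ η, (ENNReal.ofReal ((1 + ‖η‖) ^ (K + 1)) * ∑ j, ‖v s η j‖ₑ) ^ 2 ≤ S₁ :=
    fun s => lintegral_weight_majorant_hsub_sq_le c T a E hc ha s (hB₁ s)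
  set b : ℝ≥0∞ := ENNReal.ofReal T * (ENNReal.ofReal (4 * π) * (Fintype.card ι : ℝ≥0∞) ^ 2 *
    2 ^ (K + 2) * (S₀ ^ (1 / 2 : ℝ) * S₁ ^ (1 / 2 : ℝ))) with hb
  have hbtop : b ≠ ⊤ := by
    refine ENNReal.mul_ne_top ENNReal.ofReal_ne_top (ENNReal.mul_ne_top (ENNReal.mul_ne_top
      (ENNReal.mul_ne_top ENNReal.ofReal_ne_top (by simp)) (by simp)) (ENNReal.mul_ne_top ?_ ?_))
    · exact ENNReal.rpow_ne_top_of_nonneg (by norm_num) hS₀top.ne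
    · exact ENNReal.rpow_ne_top_of_nonneg (by norm_num) hS₁top.ne
  refine ⟨b.toReal, fun t => hasDecay_of_weight_mul_enorm_le hbtop fun ξ => ?_⟩
  exact weight_mul_enorm_duhamelIntegral_le hc hT hvm K hmom0 hmom1 t ξ
  where
  /-- weighted square moments of the majorant of `a` from those of the components -/
  lintegral_weight_majorant_sq_le' {a : EuclideanSpace ℝ ι → ι → ℂ} (ha : AEStronglyMeasurable a volume)
      (k : ℕ) : ∫⁻ η, (ENNReal.ofReal ((1 + ‖η‖) ^ k) * ∑ j, ‖a η j‖ₑ) ^ 2 ≤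
        (Fintype.card ι : ℝ≥0∞) * ∑ j, ∫⁻ η, (ENNReal.ofReal ((1 + ‖η‖) ^ k) * ‖a η j‖ₑ) ^ 2 := by
    calc ∫⁻ η, (ENNReal.ofReal ((1 + ‖η‖) ^ k) * ∑ j, ‖a η j‖ₑ) ^ 2
        ≤ ∫⁻ η, (Fintype.card ι : ℝ≥0∞) * ∑ j, (ENNReal.ofReal ((1 + ‖η‖) ^ k) * ‖a η j‖ₑ) ^ 2 := by
          refine lintegral_mono fun η => ?_
          rw [mul_pow]
          calc ENNReal.ofReal ((1 + ‖η‖) ^ k) ^ 2 * (∑ j, ‖a η j‖ₑ) ^ 2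
              ≤ ENNReal.ofReal ((1 + ‖η‖) ^ k) ^ 2 * ((Fintype.card ι : ℝ≥0∞) * ∑ j, ‖a η j‖ₑ ^ 2) := by
                gcongr; exact majorant_sq_le a η
            _ = (Fintype.card ι : ℝ≥0∞) * ∑ j, (ENNReal.ofReal ((1 + ‖η‖) ^ k) * ‖a η j‖ₑ) ^ 2 := by
                rw [Finset.mul_sum, Finset.mul_sum, Finset.mul_sum]
                refine Finset.sum_congr rfl fun j _ => ?_
                ring
      _ = (Fintype.card ι : ℝ≥0∞) * ∑ j, ∫⁻ η, (ENNReal.ofReal ((1 + ‖η‖) ^ k) * ‖a η j‖ₑ) ^ 2 := by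
          rw [lintegral_const_mul' _ _ (by simp), lintegral_finsetSum' _ fun j _ => ?_]
          exact (((measurable_ofReal_weight k).aemeasurable.mul (aesm_apply ha j).enorm).pow_const 2)

/-- **The Duhamel map preserves the class.** For `c, T ≥ 0`, a measurable datum with all weighted
square moments finite and a jointly continuous `E` with pointwise decay of every order uniformly
in time, the Duhamel integral of `v = h - E` is again jointly continuous with pointwise decay of
every order uniformly in time. [folklore] -/
theorem class_duhamelIntegral (hc : 0 ≤ c) (hT : 0 ≤ T) (ha : AEStronglyMeasurable a volume)
    (haw : ∀ (k : ℕ) j, ∫⁻ η, (ENNReal.ofReal ((1 + ‖η‖) ^ k) * ‖a η j‖ₑ) ^ 2 < ⊤)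
    (hEc : Continuous (uncurry E)) (hEd : ∀ K : ℕ, ∃ B : ℝ, ∀ t, HasDecay K B (E t)) :
    Continuous (uncurry (duhamelIntegral c T (fun s η => heat c η (clamp T s) • a η - E s η))) ∧
      ∀ K : ℕ, ∃ B : ℝ, ∀ t,
        HasDecay K B (duhamelIntegral c T (fun s η => heat c η (clamp T s) • a η - E s η) t) :=
  class_duhamelIntegral' hc hT ha haw hEc.measurable (fun η => hEc.uncurry_right η) hEd

omit [DecidableEq ι] in
/-- Weighted square moments of the majorant of `a` from those of the components (the auxiliary of
`class_duhamelIntegral`, kept under its original name).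
[cite: Tao2011, Thm. 5.4 (ii) WITH force (arXiv:1108.1165 Thm. 31 (ii), p. 18);
proof of Thm. 5.1 (arXiv Thm. 28, p. 16)] -/
theorem class_duhamelIntegral.lintegral_weight_majorant_sq_le' {a : EuclideanSpace ℝ ι → ι → ℂ}
    (ha : AEStronglyMeasurable a volume) (k : ℕ) :
    ∫⁻ η, (ENNReal.ofReal ((1 + ‖η‖) ^ k) * ∑ j, ‖a η j‖ₑ) ^ 2 ≤
      (Fintype.card ι : ℝ≥0∞) * ∑ j, ∫⁻ η, (ENNReal.ofReal ((1 + ‖η‖) ^ k) * ‖a η j‖ₑ) ^ 2 :=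
  class_duhamelIntegral'.lintegral_weight_majorant_sq_le' ha k

/-- **The class of every Picard iterate.** For `c, T ≥ 0` and a measurable datum `a` with all
weighted square moments finite, the Duhamel part `E_n = h - v_n` of the `n`-th Picard iterate
`v_n = picardIter c T a n` (`h(t) = heat(clamp t) • a`) is jointly continuous with pointwise
polynomial decay of every order, uniformly in time (Leray's successive approximations, 1934, §19,
run in the `L²` class: `E_0 = 0`, `E_{n+1} = duhamelIntegral c T v_n`). [folklore] -/
theorem class_picardIter (hc : 0 ≤ c) (hT : 0 ≤ T) (ha : AEStronglyMeasurable a volume)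
    (haw : ∀ (k : ℕ) j, ∫⁻ η, (ENNReal.ofReal ((1 + ‖η‖) ^ k) * ‖a η j‖ₑ) ^ 2 < ⊤) (n : ℕ) :
    Continuous (uncurry fun t ξ => heat c ξ (clamp T t) • a ξ - picardIter c T a n t ξ) ∧
      ∀ K : ℕ, ∃ B : ℝ, ∀ t,
        HasDecay K B (fun ξ => heat c ξ (clamp T t) • a ξ - picardIter c T a n t ξ) := by
  induction n with
  | zero =>
    have h0 : (fun t ξ => heat c ξ (clamp T t) • a ξ - picardIter c T a 0 t ξ) = fun _ _ => 0 := by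
      funext t ξ; simp [picardIter]
    refine ⟨by rw [h0]; exact continuous_const, fun K => ⟨0, fun t => ?_⟩⟩
    rw [show (fun ξ => heat c ξ (clamp T t) • a ξ - picardIter c T a 0 t ξ) = 0 from
      funext fun ξ => by simp [picardIter]]
    exact HasDecay.zero K
  | succ n ih =>
    set En : ℝ → EuclideanSpace ℝ ι → ι → ℂ :=
      fun t ξ => heat c ξ (clamp T t) • a ξ - picardIter c T a n t ξ with hEn
    have hvn : (fun s η => heat c η (clamp T s) • a η - En s η) = picardIter c T a n := by
      funext s η; simp [hEn]
    have hstep : (fun t ξ => heat c ξ (clamp T t) • a ξ - picardIter c T a (n + 1) t ξ) =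
        duhamelIntegral c T (fun s η => heat c η (clamp T s) • a η - En s η) := by
      funext t ξ
      rw [hvn, picardIter, duhamel_eq, sub_sub_cancel]
    obtain ⟨hcont, hdec⟩ := class_duhamelIntegral hc hT ha haw ih.1 ih.2
    refine ⟨by rw [hstep]; exact hcont, fun K => (hdec K).imp fun B hB t => ?_⟩
    rw [show (fun ξ => heat c ξ (clamp T t) • a ξ - picardIter c T a (n + 1) t ξ) =
      duhamelIntegral c T (fun s η => heat c η (clamp T s) • a η - En s η) t from congrFun hstep t]
    exact hB t

end Class

end Literature.Analysis.FluidPDE.FourierNS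

end
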